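import Literature.Combinatorics.Sahi2008.Functional
import HarnessLib

/-!
# `NoHeavyLowerTail` (stmt-CriticalPhenomena-4575) — Sahi's `E_4` with one free slot: first-slot expansion and cell decomposition

Support file, seat `prim-l12-p5` (gen 17), `--supports stmt-CriticalPhenomena-4575`.  Standard axioms, no sorries, no definitions, no named facts.
Generic algebra behind the free-slot region reduction (memo FROM-prim-l12-p5-g17-FREE-SLOT-REGION-REDUCTION §1(i)–(ii)), for ANY finite weight `μ`:
* `sahiE_four_eq_ex_mul_Z` — the Lieb–Sahi recursion (the tree's definition of `sahiE`) plus `sahiE_three` give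
  `E_4(f; g₀,g₁,g₂) = E[f·Z]`, `Z = 6g₀g₁g₂ − 2Σ_k E(g_k)·g_ig_j − Σ_j Cov(g_k,g_l)·g_j − E_3(g)`;
* `ex_comp_eq_sum_cells`, `ex_mul_comp_eq_sum_cells` — fibrewise decomposition of moments along a cell map `c : α → N`;
* **`sahiE_four_eq_sum_cells`** — if the three `g_j` factor through `c` (`g_j = γ_j ∘ c`), then `E_4(f; g) = Σ_n ζ_n · v_n` with
  `v_n = E[f·1_{c=n}]`, cell masses `P_n = E[1_{c=n}]`, and `ζ_n` the explicit cubic in the `P`'s displayed in the statement.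
[this work; cite: LiebSahi2021, Prop. 3.3 and Def. 3.1]
-/

namespace Summit.CriticalPhenomena.PercolationContinuityZ3.Theorems

namespace SahiFreeSlot

open Finset Literature.Combinatorics.Sahi2008

variable {α : Type*} [Fintype α]

/-- `E` of `f` times a linear combination of the products of `g₀,g₁,g₂`. [folklore] -/
theorem ex_mul_linComb (μ f g₀ g₁ g₂ : α → ℝ) (a b₀ b₁ b₂ c₀ c₁ c₂ d : ℝ) :
    ex μ (fun ω => f ω * (a * (g₀ ω * g₁ ω * g₂ ω) + b₀ * (g₁ ω * g₂ ω) + b₁ * (g₀ ω * g₂ ω) + b₂ * (g₀ ω * g₁ ω)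
      + c₀ * g₀ ω + c₁ * g₁ ω + c₂ * g₂ ω + d))
    = a * ex μ (fun ω => f ω * g₀ ω * g₁ ω * g₂ ω) + b₀ * ex μ (fun ω => f ω * g₁ ω * g₂ ω)
      + b₁ * ex μ (fun ω => f ω * g₀ ω * g₂ ω) + b₂ * ex μ (fun ω => f ω * g₀ ω * g₁ ω)
      + c₀ * ex μ (fun ω => f ω * g₀ ω) + c₁ * ex μ (fun ω => f ω * g₁ ω) + c₂ * ex μ (fun ω => f ω * g₂ ω) + d * ex μ f := by
  simp only [ex, Finset.mul_sum, ← Finset.sum_add_distrib]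
  exact Finset.sum_congr rfl fun x _ => by ring

/-- **First-slot expansion of `E_4`**: `E_4(f; g₀,g₁,g₂) = E[f · Z]` with
`Z = 6g₀g₁g₂ − 2(E g₀·g₁g₂ + E g₁·g₀g₂ + E g₂·g₀g₁) − (Cov(g₁,g₂)g₀ + Cov(g₀,g₂)g₁ + Cov(g₀,g₁)g₂) − E_3(g₀,g₁,g₂)`.
[this work; cite: LiebSahi2021, Prop. 3.3] -/
theorem sahiE_four_eq_ex_mul_Z (μ : α → ℝ) (f g₀ g₁ g₂ : α → ℝ) :
    sahiE μ 4 ![f, g₀, g₁, g₂] = ex μ (fun ω => f ω * (6 * (g₀ ω * g₁ ω * g₂ ω)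
      + (-2 * ex μ g₀) * (g₁ ω * g₂ ω) + (-2 * ex μ g₁) * (g₀ ω * g₂ ω) + (-2 * ex μ g₂) * (g₀ ω * g₁ ω)
      + (-(ex μ (fun ω => g₁ ω * g₂ ω) - ex μ g₁ * ex μ g₂)) * g₀ ω
      + (-(ex μ (fun ω => g₀ ω * g₂ ω) - ex μ g₀ * ex μ g₂)) * g₁ ω
      + (-(ex μ (fun ω => g₀ ω * g₁ ω) - ex μ g₀ * ex μ g₁)) * g₂ ω
      + (-sahiE μ 3 ![g₀, g₁, g₂]))) := by
  rw [ex_mul_linComb]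
  rw [show (![f, g₀, g₁, g₂] : Fin 4 → α → ℝ) = Matrix.vecCons f ![g₀, g₁, g₂] from rfl, sahiE_cons]
  rw [Fin.sum_univ_three, sahiE_three_apply, sahiE_three_apply, sahiE_three_apply, sahiE_three]
  simp only [Function.update_apply, Matrix.cons_val_zero, Matrix.cons_val_one, Matrix.cons_val, ex]
  simp only [Fin.isValue, Fin.reduceEq, if_true, if_false, Pi.mul_apply]
  simp only [mul_assoc, mul_comm, mul_left_comm]
  ring_nf

variable {N : Type*} [Fintype N] [DecidableEq N]

/-- Fibrewise decomposition of a moment along a cell map. [folklore] -/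
theorem ex_comp_eq_sum_cells (μ : α → ℝ) (c : α → N) (φ : N → ℝ) :
    ex μ (fun ω => φ (c ω)) = ∑ n, φ n * ex μ (fun ω => if c ω = n then 1 else 0) := by
  simp only [ex, Finset.mul_sum]
  rw [Finset.sum_comm]
  refine Finset.sum_congr rfl fun ω _ => ?_
  simp only [mul_ite, mul_one, mul_zero]
  rw [Finset.sum_ite_eq]
  simp only [mem_univ, if_true]
  ring

/-- Fibrewise decomposition of `E[F · φ(c)]` along a cell map. [folklore] -/
theorem ex_mul_comp_eq_sum_cells (μ F : α → ℝ) (c : α → N) (φ : N → ℝ) :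
    ex μ (fun ω => F ω * φ (c ω)) = ∑ n, φ n * ex μ (fun ω => F ω * if c ω = n then 1 else 0) := by
  simp only [ex, Finset.mul_sum]
  rw [Finset.sum_comm]
  refine Finset.sum_congr rfl fun ω _ => ?_
  simp only [mul_ite, mul_one, mul_zero]
  rw [Finset.sum_ite_eq]
  simp only [mem_univ, if_true]
  ring

/-- Fibrewise decomposition, for a function that factors through the cell map. [folklore] -/
theorem ex_eq_sum_cells_of (μ g : α → ℝ) (c : α → N) (φ : N → ℝ) (h : ∀ ω, g ω = φ (c ω)) :
    ex μ g = ∑ n, φ n * ex μ (fun ω => if c ω = n then 1 else 0) := by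
  rw [show g = fun ω => φ (c ω) from funext h]
  exact ex_comp_eq_sum_cells μ c φ

/-- Fibrewise decomposition of `E[g]` for `g = F · (φ ∘ c)`. [folklore] -/
theorem ex_mul_eq_sum_cells_of (μ F g : α → ℝ) (c : α → N) (φ : N → ℝ) (h : ∀ ω, g ω = F ω * φ (c ω)) :
    ex μ g = ∑ n, φ n * ex μ (fun ω => F ω * if c ω = n then 1 else 0) := by
  rw [show g = fun ω => F ω * φ (c ω) from funext h]
  exact ex_mul_comp_eq_sum_cells μ F c φ

/-- **Cell decomposition of `E_4` with one free slot.**  If `g_j = γ_j ∘ c` for a cell map `c : α → N`, then with cell masses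
`P n = E[1_{c=n}]` and free-slot cell moments `v n = E[f·1_{c=n}]`,
`E_4(f; g₀,g₁,g₂) = Σ_n ζ_n v_n` where `ζ_n` is the displayed cubic (`6γ₀γ₁γ₂(n) − 2Σ m_k γ_iγ_j(n) − Σ Cov_{kl} γ_j(n) − E_3`, all moments of
the `g`'s written through the cells). [this work; cite: LiebSahi2021, Prop. 3.3] -/
theorem sahiE_four_eq_sum_cells (μ : α → ℝ) (f g₀ g₁ g₂ : α → ℝ) (c : α → N) (γ₀ γ₁ γ₂ : N → ℝ)
    (h₀ : ∀ ω, g₀ ω = γ₀ (c ω)) (h₁ : ∀ ω, g₁ ω = γ₁ (c ω)) (h₂ : ∀ ω, g₂ ω = γ₂ (c ω))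
    (P v : N → ℝ) (hP : ∀ n, P n = ex μ (fun ω => if c ω = n then 1 else 0))
    (hv : ∀ n, v n = ex μ (fun ω => f ω * if c ω = n then 1 else 0)) :
    sahiE μ 4 ![f, g₀, g₁, g₂] =
      ∑ n, (6 * (γ₀ n * γ₁ n * γ₂ n)
        + (-2 * ∑ m, γ₀ m * P m) * (γ₁ n * γ₂ n) + (-2 * ∑ m, γ₁ m * P m) * (γ₀ n * γ₂ n)
        + (-2 * ∑ m, γ₂ m * P m) * (γ₀ n * γ₁ n)
        + (-((∑ m, γ₁ m * γ₂ m * P m) - (∑ m, γ₁ m * P m) * (∑ m, γ₂ m * P m))) * γ₀ n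
        + (-((∑ m, γ₀ m * γ₂ m * P m) - (∑ m, γ₀ m * P m) * (∑ m, γ₂ m * P m))) * γ₁ n
        + (-((∑ m, γ₀ m * γ₁ m * P m) - (∑ m, γ₀ m * P m) * (∑ m, γ₁ m * P m))) * γ₂ n
        + (-(2 * (∑ m, γ₀ m * γ₁ m * γ₂ m * P m) + (∑ m, γ₀ m * P m) * (∑ m, γ₁ m * P m) * (∑ m, γ₂ m * P m)
            - ((∑ m, γ₀ m * P m) * (∑ m, γ₁ m * γ₂ m * P m) + (∑ m, γ₁ m * P m) * (∑ m, γ₀ m * γ₂ m * P m)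
              + (∑ m, γ₂ m * P m) * (∑ m, γ₀ m * γ₁ m * P m))))) * v n := by
  -- moments of the `g`'s through the cells
  have e0 : ex μ g₀ = ∑ m, γ₀ m * P m := by
    rw [ex_eq_sum_cells_of μ g₀ c γ₀ h₀]; simp only [hP]
  have e1 : ex μ g₁ = ∑ m, γ₁ m * P m := by
    rw [ex_eq_sum_cells_of μ g₁ c γ₁ h₁]; simp only [hP]
  have e2 : ex μ g₂ = ∑ m, γ₂ m * P m := by
    rw [ex_eq_sum_cells_of μ g₂ c γ₂ h₂]; simp only [hP]
  have e12 : ex μ (fun ω => g₁ ω * g₂ ω) = ∑ m, γ₁ m * γ₂ m * P m := by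
    rw [ex_eq_sum_cells_of μ _ c (fun n => γ₁ n * γ₂ n) (fun ω => by simp only [h₁, h₂])]; simp only [hP]
  have e02 : ex μ (fun ω => g₀ ω * g₂ ω) = ∑ m, γ₀ m * γ₂ m * P m := by
    rw [ex_eq_sum_cells_of μ _ c (fun n => γ₀ n * γ₂ n) (fun ω => by simp only [h₀, h₂])]; simp only [hP]
  have e01 : ex μ (fun ω => g₀ ω * g₁ ω) = ∑ m, γ₀ m * γ₁ m * P m := by
    rw [ex_eq_sum_cells_of μ _ c (fun n => γ₀ n * γ₁ n) (fun ω => by simp only [h₀, h₁])]; simp only [hP]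
  have e012 : ex μ (fun ω => g₀ ω * g₁ ω * g₂ ω) = ∑ m, γ₀ m * γ₁ m * γ₂ m * P m := by
    rw [ex_eq_sum_cells_of μ _ c (fun n => γ₀ n * γ₁ n * γ₂ n) (fun ω => by simp only [h₀, h₁, h₂])]; simp only [hP]
  have e3 : sahiE μ 3 ![g₀, g₁, g₂] = 2 * (∑ m, γ₀ m * γ₁ m * γ₂ m * P m)
      + (∑ m, γ₀ m * P m) * (∑ m, γ₁ m * P m) * (∑ m, γ₂ m * P m)
      - ((∑ m, γ₀ m * P m) * (∑ m, γ₁ m * γ₂ m * P m) + (∑ m, γ₁ m * P m) * (∑ m, γ₀ m * γ₂ m * P m)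
        + (∑ m, γ₂ m * P m) * (∑ m, γ₀ m * γ₁ m * P m)) := by
    rw [sahiE_three, ← e0, ← e1, ← e2, ← e12, ← e02, ← e01, ← e012]
    rfl
  rw [sahiE_four_eq_ex_mul_Z, e0, e1, e2, e12, e02, e01, e3]
  -- the integrand factors through the cells
  rw [ex_mul_eq_sum_cells_of μ f _ c (fun n => 6 * (γ₀ n * γ₁ n * γ₂ n)
        + (-2 * ∑ m, γ₀ m * P m) * (γ₁ n * γ₂ n) + (-2 * ∑ m, γ₁ m * P m) * (γ₀ n * γ₂ n)
        + (-2 * ∑ m, γ₂ m * P m) * (γ₀ n * γ₁ n)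
        + (-((∑ m, γ₁ m * γ₂ m * P m) - (∑ m, γ₁ m * P m) * (∑ m, γ₂ m * P m))) * γ₀ n
        + (-((∑ m, γ₀ m * γ₂ m * P m) - (∑ m, γ₀ m * P m) * (∑ m, γ₂ m * P m))) * γ₁ n
        + (-((∑ m, γ₀ m * γ₁ m * P m) - (∑ m, γ₀ m * P m) * (∑ m, γ₁ m * P m))) * γ₂ n
        + (-(2 * (∑ m, γ₀ m * γ₁ m * γ₂ m * P m) + (∑ m, γ₀ m * P m) * (∑ m, γ₁ m * P m) * (∑ m, γ₂ m * P m)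
            - ((∑ m, γ₀ m * P m) * (∑ m, γ₁ m * γ₂ m * P m) + (∑ m, γ₁ m * P m) * (∑ m, γ₀ m * γ₂ m * P m)
              + (∑ m, γ₂ m * P m) * (∑ m, γ₀ m * γ₁ m * P m)))))
      (fun ω => by simp only [h₀, h₁, h₂])]
  exact Finset.sum_congr rfl fun n _ => by rw [hv]

end SahiFreeSlot

end Summit.CriticalPhenomena.PercolationContinuityZ3.Theorems
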